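import Literature.Analysis.FluidPDE.SawtoothCascade
import HarnessLib

/-!
# The per-phase Kelvin–Helmholtz cap of the sawtooth cascade, CLASSICAL typing (`K2PhaseGrowthClassical`)

One-definition sequel of `SawtoothCascade.lean` (cell `ad-ideate`, seat ad-p2 tenure planner g7; queue item
`defn-SawtoothCascadeK2PhaseGrowthClassical`; text = `HOME/ad-ideate-p2/route/lines/K2LinearisedCascadeGrowth_classical-def.lean`,
farm rc 0, landed verbatim): the CLASSICAL re-typing of the receptacle `SawtoothCascade.K2PhaseGrowth P C`
advised by the cell's literature seat (ad-lit g8, verdict L8).  `K2PhaseGrowth` quantifies over WEAK passive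
vector solutions `Torus.IsWeakPassiveVectorOn 1` on the shifted window, a class for which the tree has no
uniqueness theorem, so a statement over it silently carries weak-class uniqueness; `K2PhaseGrowthClassical`
quantifies instead over CLASSICAL solutions `(w, q)` of the Navier–Stokes equations linearised at the cascade
carrier `ū = P.field` (Yoshida–Kaneda's passive-vector / linearised model with `(α, β) = (1, 1)`) on the
compact absolute-time window `[tInject j₀ hz, tStart (J+1)]` — `w`, `q` jointly smooth there, `w(t)` divergence
free, `∂ₜw + (ū·∇)w + (w·∇)ū = νΔw − ∇q` pointwise with the one-sided time derivative on the window, and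
`w(tInject j₀ hz) = w₀` — exactly the class of the tree's `Torus.linearisedNS_exists` (non-empty) and
`Torus.linearisedNS_unique` (a singleton).  Same datum class `ShearCombDatum (P.N j₀) hz w₀`, same quantifier
order `∃ ν₀, ∀ ν ∈ (0, ν₀], ∀ j₀ ≤ J, ∀ hz`, same conclusion
`‖w(t)‖²_{L²} ≤ (C e^{σ⋆γ})^{2(J+1−j₀)} ‖w₀‖²_{L²}` for `t ∈ [max (tInject j₀ hz) (tStart J), tStart (J+1)]`.

A predicate of the parameter point `P` and the constant `C` (a receptacle: nothing asserts it); the route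
restates its crux `K2LinearisedCascadeGrowth` as `∀ γ ∈ [4,8], ∀ ρN ∈ {2,…,7}, K2PhaseGrowthClassical ⟨γ, 1/4, 2, 1, ρN⟩ 3`.
No implication with the weak form is proved here (the tree has no classical ⇒ weak passive-vector bridge on a
shifted window; not needed by the route).
[cite: YoshidaKaneda2000, §II eq. (4)-(5) ((α,β)=(1,1): the linearised Navier–Stokes / passive-vector model)]
[cite: Drazin2002, §8.3 Example 8.3 and Exercise 8.10 (the rate σ⋆ per unit strain)] [problem: turb]
-/

open Set

namespace Literature.Analysis.FluidPDE.SawtoothCascade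

open FunctionSpaces

/-- **K2″ for one parameter set, CLASSICAL typing**: every residual-class injection `w₀` (a `ShearCombDatum` at
phase `j₀`, H or V half) is amplified by at most `(C e^{σ⋆ γ})^{J − j₀ + 1}` in velocity `L²` during phase
`J ≥ j₀`, for every classical solution `(w, q)` of the Navier–Stokes equations linearised at the cascade
carrier — `w`, `q` jointly smooth on `[tInject j₀ hz, tStart (J+1)] × 𝕋²`, `w(t)` divergence free,
`∂ₜw + (ū·∇)w + (w·∇)ū = νΔw − ∇q` pointwise (one-sided time derivative on the window),
`w(tInject j₀ hz) = w₀` — uniformly in `ν ∈ (0, ν₀]` with ONE threshold `ν₀` for all `j₀ ≤ J`.  The class is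
the one of `Torus.linearisedNS_exists` (non-empty) and `Torus.linearisedNS_unique` (a singleton), so no
weak-solution uniqueness is hidden in the statement (the weak-class receptacle is `K2PhaseGrowth`).
[cite: YoshidaKaneda2000, §II eq. (4)-(5) ((α,β)=(1,1): the linearised Navier–Stokes / passive-vector model)] -/
def K2PhaseGrowthClassical (P : CascadeParams) (C : ℝ) : Prop :=
  ∃ ν₀ : ℝ, 0 < ν₀ ∧ ∀ ν ∈ Ioc 0 ν₀, ∀ (j₀ J : ℕ), j₀ ≤ J → ∀ (hz : Bool)
    (w₀ : UnitAddTorus (Fin 2) → EuclideanSpace ℝ (Fin 2))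
    (w : ℝ → UnitAddTorus (Fin 2) → EuclideanSpace ℝ (Fin 2)) (q : ℝ → UnitAddTorus (Fin 2) → ℝ),
    ShearCombDatum (P.N j₀) hz w₀ →
    Torus.IsSmoothSpaceTimeOn (Icc (CascadeParams.tInject j₀ hz) (CascadeParams.tStart (J + 1))) w →
    Torus.IsSmoothSpaceTimeOn (Icc (CascadeParams.tInject j₀ hz) (CascadeParams.tStart (J + 1))) q →
    (∀ t ∈ Icc (CascadeParams.tInject j₀ hz) (CascadeParams.tStart (J + 1)), Torus.IsDivFree (w t)) →
    (∀ t ∈ Icc (CascadeParams.tInject j₀ hz) (CascadeParams.tStart (J + 1)), ∀ x,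
      Torus.timeDerivWithin (Icc (CascadeParams.tInject j₀ hz) (CascadeParams.tStart (J + 1))) w t x +
        Torus.convect (P.field t) (w t) x + Torus.convect (w t) (P.field t) x =
        ν • Torus.laplacian (w t) x - Torus.gradient (q t) x) →
    w (CascadeParams.tInject j₀ hz) = w₀ →
    ∀ t ∈ Icc (max (CascadeParams.tInject j₀ hz) (CascadeParams.tStart J)) (CascadeParams.tStart (J + 1)),
      Torus.vectorL2Sq (w t) ≤ (C * Real.exp (sawSigmaStar * P.γ)) ^ (2 * (J + 1 - j₀)) * Torus.vectorL2Sq w₀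

/-- The cap is monotone in the constant: a bound with constant `C` gives the bound with any `C' ≥ C` when
`0 ≤ C` (the right-hand side is `(C e^{σ⋆γ})^{2k} ‖w₀‖²` with `‖w₀‖² ≥ 0`).
[cite: YoshidaKaneda2000, §II eq. (4)-(5)] -/
theorem K2PhaseGrowthClassical.mono {P : CascadeParams} {C C' : ℝ} (h : K2PhaseGrowthClassical P C)
    (hC : 0 ≤ C) (hCC' : C ≤ C') : K2PhaseGrowthClassical P C' := by
  obtain ⟨ν₀, hν₀, H⟩ := h
  refine ⟨ν₀, hν₀, fun ν hν j₀ J hj hz w₀ w q hd hw hq hdiv heq h0 t ht => ?_⟩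
  have h1 := H ν hν j₀ J hj hz w₀ w q hd hw hq hdiv heq h0 t ht
  refine h1.trans (mul_le_mul_of_nonneg_right ?_ ?_)
  · have hE : 0 ≤ C * Real.exp (sawSigmaStar * P.γ) := mul_nonneg hC (Real.exp_pos _).le
    exact pow_le_pow_left₀ hE (mul_le_mul_of_nonneg_right hCC' (Real.exp_pos _).le) _
  · unfold Torus.vectorL2Sq
    exact MeasureTheory.integral_nonneg fun _ => by positivity

/-- **K2″ WITHIN THE HORIZON, CLASSICAL typing** (receptacle — nothing asserts it): for every lag `A` a threshold
`ν₀(A) > 0` such that for `ν ∈ (0, ν₀]` the per-phase cap `(C e^{σ⋆γ})^{J+1−j₀}` of `K2PhaseGrowthClassical P C`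
holds for the phases `j₀ ≤ J < J_{γ²−3}(ν) + A` strictly below the horizon phase only (`Jrate (P.γ²−3) ν`, the
dissipation-threshold phase of `K1Localised`); same datum class, same classical solution class, same conclusion.  These
are exactly the phases in which the closure `K1loc ∧ K2 → Target` of the route `SawtoothPulseCascade` applies the cap
(there the analyticity budget `16π²νN_J²tHalf_J ≤ δ_J²` holds: viscosity is perturbative at the corner scale), so this
is the weakest per-phase statement the route consumes; `K2PhaseGrowthClassical.within` recovers it from the all-phases form.
[cite: YoshidaKaneda2000, §II eq. (4)-(5) ((α,β)=(1,1): the linearised Navier–Stokes / passive-vector model)]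
[cite: Drazin2002, §8.3 Example 8.3 and Exercise 8.10 (the rate σ⋆ per unit strain)] -/
def K2PhaseGrowthClassicalH (P : CascadeParams) (C : ℝ) : Prop :=
  ∀ A : ℕ, ∃ ν₀ : ℝ, 0 < ν₀ ∧ ∀ ν ∈ Ioc 0 ν₀, ∀ (j₀ J : ℕ), j₀ ≤ J → J < Jrate (P.γ ^ 2 - 3) ν + A → ∀ (hz : Bool)
    (w₀ : UnitAddTorus (Fin 2) → EuclideanSpace ℝ (Fin 2))
    (w : ℝ → UnitAddTorus (Fin 2) → EuclideanSpace ℝ (Fin 2)) (q : ℝ → UnitAddTorus (Fin 2) → ℝ),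
    ShearCombDatum (P.N j₀) hz w₀ →
    Torus.IsSmoothSpaceTimeOn (Icc (CascadeParams.tInject j₀ hz) (CascadeParams.tStart (J + 1))) w →
    Torus.IsSmoothSpaceTimeOn (Icc (CascadeParams.tInject j₀ hz) (CascadeParams.tStart (J + 1))) q →
    (∀ t ∈ Icc (CascadeParams.tInject j₀ hz) (CascadeParams.tStart (J + 1)), Torus.IsDivFree (w t)) →
    (∀ t ∈ Icc (CascadeParams.tInject j₀ hz) (CascadeParams.tStart (J + 1)), ∀ x,
      Torus.timeDerivWithin (Icc (CascadeParams.tInject j₀ hz) (CascadeParams.tStart (J + 1))) w t x +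
        Torus.convect (P.field t) (w t) x + Torus.convect (w t) (P.field t) x =
        ν • Torus.laplacian (w t) x - Torus.gradient (q t) x) →
    w (CascadeParams.tInject j₀ hz) = w₀ →
    ∀ t ∈ Icc (max (CascadeParams.tInject j₀ hz) (CascadeParams.tStart J)) (CascadeParams.tStart (J + 1)),
      Torus.vectorL2Sq (w t) ≤ (C * Real.exp (sawSigmaStar * P.γ)) ^ (2 * (J + 1 - j₀)) * Torus.vectorL2Sq w₀

/-- The all-phases cap implies the cap within the horizon (drop the guard; the threshold does not depend on the lag).
[cite: YoshidaKaneda2000, §II eq. (4)-(5)] -/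
theorem K2PhaseGrowthClassical.within {P : CascadeParams} {C : ℝ} (h : K2PhaseGrowthClassical P C) :
    K2PhaseGrowthClassicalH P C := by
  intro A
  obtain ⟨ν₀, hν₀, H⟩ := h
  exact ⟨ν₀, hν₀, fun ν hν j₀ J hj _ => H ν hν j₀ J hj⟩

/-- The cap within the horizon is monotone in the constant (`0 ≤ C ≤ C'`). [cite: YoshidaKaneda2000, §II eq. (4)-(5)] -/
theorem K2PhaseGrowthClassicalH.mono {P : CascadeParams} {C C' : ℝ} (h : K2PhaseGrowthClassicalH P C)
    (hC : 0 ≤ C) (hCC' : C ≤ C') : K2PhaseGrowthClassicalH P C' := by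
  intro A
  obtain ⟨ν₀, hν₀, H⟩ := h A
  refine ⟨ν₀, hν₀, fun ν hν j₀ J hj hJ hz w₀ w q hd hw hq hdiv heq h0 t ht => ?_⟩
  have h1 := H ν hν j₀ J hj hJ hz w₀ w q hd hw hq hdiv heq h0 t ht
  refine h1.trans (mul_le_mul_of_nonneg_right ?_ ?_)
  · have hE : 0 ≤ C * Real.exp (sawSigmaStar * P.γ) := mul_nonneg hC (Real.exp_pos _).le
    exact pow_le_pow_left₀ hE (mul_le_mul_of_nonneg_right hCC' (Real.exp_pos _).le) _
  · unfold Torus.vectorL2Sq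
    exact MeasureTheory.integral_nonneg fun _ => by positivity

end Literature.Analysis.FluidPDE.SawtoothCascade
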